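import Summits.SmoothPoincare4.SmoothPoincare4.Theorems.SullivanDualTargetStubLiouvilleCollarStar
import Literature.Geometry.Symplectic.GromovR4StdModel

/-!
# The flow-out map of the Liouville collar: pointwise calculus

Helper file of stub `stub_liouvilleCollar` (line `kaehler-jacket`, crux stmt-SmoothPoincare4-7823;
Geiges 2008, Lemma 5.2.4).  Let `θ : ℝ × ℝ⁴ → ℝ⁴` be a smooth flow of a smooth vector field `V`
(`θ(0, x) = x`, `∂ₜ θ(t, x) = V(θ(t, x))`), `c ∈ ℝ⁴`, `μ > 0`, `A` a linear isometry.  The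
**flow-out map** of the round sphere `S_μ(c) = {c + μ A θ̂ : ‖θ̂‖ = 1}` in logarithmic polar
coordinates is
`Λ z = θ(2 log ‖z‖, c + μ A (z/‖z‖))` (`z ≠ 0`): it sends the ray through `θ̂` to the flow line
through `c + μ A θ̂`, the unit sphere onto `S_μ(c)`, and the Euler field `z ∂_z` to `2 V`:

* `flowOut_contDiffAt` — `Λ` is smooth off the origin;
* `flowOut_fderiv_self` — `DΛ_z z = 2 V(Λ z)` (differentiate `Λ(e^s z) = θ(2s + 2 log ‖z‖, ·)`);
* `flowOut_sphere`, `flowOut_fderiv_tangent` — on the unit sphere `Λ θ̂ = c + μ A θ̂` and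
  `DΛ_θ̂ w = μ A w` for `w ⊥ θ̂` (differentiate along a great circle);
* `flowOut_fderiv_injective` — if `V` is transverse to `S_μ(c)` (`⟪V y, y − c⟫ > 0`), `DΛ_θ̂` is
  injective;
packaged as `helper_kjFlowOutCalc`.

## References

* H. Geiges, *An Introduction to Contact Topology*, CUP 2008, Lemma 5.2.4 (flow box of the
  Liouville field across a hypersurface of contact type). [Geiges2008]
* J. M. Lee, *Introduction to Smooth Manifolds*, 2nd ed. (2013), Thm. 9.20 (flow-out theorem).
-/

noncomputable section

set_option linter.dupNamespace false

open scoped Manifold ContDiff Topology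
open Set Function

namespace Summit.SmoothPoincare4.SmoothPoincare4.Theorems.Target.KaehlerJacket

/-- Model space `ℝ⁴ = ℂ²`. -/
local notation "E4" => EuclideanSpace ℝ (Fin 4)

section FlowOut

variable {θ : ℝ × E4 → E4} {V : E4 → E4} {c : E4} {μ : ℝ} {A : E4 ≃ₗᵢ[ℝ] E4} {Λ : E4 → E4}

/-- The flow-out map is smooth off the origin. [folklore] -/
theorem flowOut_contDiffAt (hθ : ContDiff ℝ ∞ θ)
    (hΛ : ∀ z, Λ z = θ (2 * Real.log ‖z‖, c + μ • A (‖z‖⁻¹ • z))) {z : E4} (hz : z ≠ 0) :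
    ContDiffAt ℝ ∞ Λ z := by
  have hfun : Λ = fun z => θ (2 * Real.log ‖z‖, c + μ • A (‖z‖⁻¹ • z)) := funext hΛ
  rw [hfun]
  refine hθ.contDiffAt.comp z (ContDiffAt.prodMk ?_ ?_)
  · exact contDiffAt_const.mul ((contDiffAt_norm ℝ hz).log (norm_ne_zero_iff.2 hz))
  · exact contDiffAt_const.add
      ((A.contDiff.contDiffAt.comp z
        (((contDiffAt_norm ℝ hz).inv (norm_ne_zero_iff.2 hz)).smul contDiffAt_id)).const_smul μ)

/-- The flow line through `c + μ A (z/‖z‖)` read through `Λ`: `Λ (e^s z) = θ(2s + 2 log ‖z‖, ·)`.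
[folklore] -/
theorem flowOut_smul_exp (hΛ : ∀ z, Λ z = θ (2 * Real.log ‖z‖, c + μ • A (‖z‖⁻¹ • z)))
    {z : E4} (hz : z ≠ 0) (s : ℝ) :
    Λ (Real.exp s • z) = θ (2 * s + 2 * Real.log ‖z‖, c + μ • A (‖z‖⁻¹ • z)) := by
  have hdir : ‖Real.exp s • z‖⁻¹ • (Real.exp s • z) = ‖z‖⁻¹ • z := by
    rw [norm_smul, Real.norm_of_nonneg (Real.exp_pos s).le, smul_smul, mul_inv, mul_assoc,
      mul_comm ‖z‖⁻¹ (Real.exp s), ← mul_assoc, inv_mul_cancel₀ (Real.exp_pos s).ne', one_mul]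
  rw [hΛ, hdir, norm_smul, Real.norm_of_nonneg (Real.exp_pos s).le,
    Real.log_mul (Real.exp_pos s).ne' (norm_ne_zero_iff.2 hz), Real.log_exp, mul_add]

/-- **`Λ` maps the Euler field to twice the flow field**: `DΛ_z z = 2 V(Λ z)` for `z ≠ 0`.
[cite: Geiges2008, Lemma 5.2.4] -/
theorem flowOut_fderiv_self (hθ : ContDiff ℝ ∞ θ)
    (hflow : ∀ x t, HasDerivAt (fun t => θ (t, x)) (V (θ (t, x))) t)
    (hΛ : ∀ z, Λ z = θ (2 * Real.log ‖z‖, c + μ • A (‖z‖⁻¹ • z))) {z : E4} (hz : z ≠ 0) :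
    fderiv ℝ Λ z z = (2 : ℝ) • V (Λ z) := by
  set P : E4 := c + μ • A (‖z‖⁻¹ • z) with hP
  set τ₀ : ℝ := 2 * Real.log ‖z‖ with hτ₀
  have hγ : HasDerivAt (fun s : ℝ => Real.exp s • z) z 0 := by
    have h := (Real.hasDerivAt_exp 0).smul_const z
    rwa [Real.exp_zero, one_smul] at h
  have hΛd : HasFDerivAt Λ (fderiv ℝ Λ z) (Real.exp 0 • z) := by
    rw [Real.exp_zero, one_smul]
    exact ((flowOut_contDiffAt hθ hΛ hz).differentiableAt (by simp)).hasFDerivAt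
  have h1 : HasDerivAt (Λ ∘ fun s : ℝ => Real.exp s • z) (fderiv ℝ Λ z z) 0 :=
    hΛd.comp_hasDerivAt 0 hγ
  have h2 : HasDerivAt (Λ ∘ fun s : ℝ => Real.exp s • z) ((2 : ℝ) • V (θ (τ₀, P))) 0 := by
    have hfun : (Λ ∘ fun s : ℝ => Real.exp s • z) = (fun t => θ (t, P)) ∘ fun s : ℝ => 2 * s + τ₀ :=
      funext fun s => flowOut_smul_exp hΛ hz s
    rw [hfun]
    have hlin : HasDerivAt (fun s : ℝ => 2 * s + τ₀) 2 0 := by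
      have h := ((hasDerivAt_id (0 : ℝ)).const_mul 2).add_const τ₀
      rwa [mul_one] at h
    have h := (hflow P (2 * 0 + τ₀)).scomp 0 hlin
    rwa [mul_zero, zero_add] at h
  have hΛz : Λ z = θ (τ₀, P) := hΛ z
  rw [hΛz]
  exact h1.unique h2

/-- On the unit sphere `Λ θ̂ = c + μ A θ̂`. [folklore] -/
theorem flowOut_sphere (hθ0 : ∀ x, θ (0, x) = x)
    (hΛ : ∀ z, Λ z = θ (2 * Real.log ‖z‖, c + μ • A (‖z‖⁻¹ • z))) {z : E4} (hz : ‖z‖ = 1) :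
    Λ z = c + μ • A z := by
  rw [hΛ, hz, Real.log_one, mul_zero, hθ0, inv_one, one_smul]

/-- **`Λ` on vectors tangent to the unit sphere**: `DΛ_θ̂ w = μ A w` for `‖θ̂‖ = 1`, `w ⊥ θ̂`.
[folklore] -/
theorem flowOut_fderiv_tangent (hθ : ContDiff ℝ ∞ θ) (hθ0 : ∀ x, θ (0, x) = x)
    (hΛ : ∀ z, Λ z = θ (2 * Real.log ‖z‖, c + μ • A (‖z‖⁻¹ • z))) {z : E4} (hz : ‖z‖ = 1)
    (w : E4) (hw : inner ℝ w z = 0) : fderiv ℝ Λ z w = μ • A w := by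
  have hz0 : z ≠ 0 := by
    rw [← norm_ne_zero_iff, hz]; exact one_ne_zero
  by_cases hw0 : w = 0
  · subst hw0
    simp
  set ŵ : E4 := ‖w‖⁻¹ • w with hŵ_def
  have hŵ1 : ‖ŵ‖ = 1 := by
    rw [norm_smul, norm_inv, norm_norm, inv_mul_cancel₀ (norm_ne_zero_iff.2 hw0)]
  have hŵz : inner ℝ ŵ z = 0 := by rw [hŵ_def, real_inner_smul_left, hw, mul_zero]
  have hwŵ : w = ‖w‖ • ŵ := by
    rw [hŵ_def, smul_smul, mul_inv_cancel₀ (norm_ne_zero_iff.2 hw0), one_smul]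
  clear_value ŵ
  set γ : ℝ → E4 := fun s => Real.cos s • z + Real.sin s • ŵ with hγ_def
  have hγ1 : ∀ s, ‖γ s‖ = 1 := norm_cos_smul_add_sin_smul hz hŵ1 hŵz
  have hγ0 : γ 0 = z := by simp [hγ_def]
  have hdγ : HasDerivAt γ ŵ 0 := by
    have h := ((Real.hasDerivAt_cos 0).smul_const z).add ((Real.hasDerivAt_sin 0).smul_const ŵ)
    simp only [Real.sin_zero, neg_zero, zero_smul, Real.cos_zero, one_smul, zero_add] at h
    exact h
  have hΛγ : Λ ∘ γ = fun s => c + μ • A (γ s) :=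
    funext fun s => flowOut_sphere hθ0 hΛ (hγ1 s)
  have h2 : HasDerivAt (Λ ∘ γ) (μ • A ŵ) 0 := by
    rw [hΛγ]
    exact (((A : E4 →L[ℝ] E4).hasFDerivAt.comp_hasDerivAt 0 hdγ).const_smul μ).const_add c
  have hΛd : HasFDerivAt Λ (fderiv ℝ Λ z) (γ 0) := by
    rw [hγ0]
    exact ((flowOut_contDiffAt hθ hΛ hz0).differentiableAt (by simp)).hasFDerivAt
  have h1 : HasDerivAt (Λ ∘ γ) (fderiv ℝ Λ z ŵ) 0 := hΛd.comp_hasDerivAt 0 hdγ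
  have hŵeq : fderiv ℝ Λ z ŵ = μ • A ŵ := h1.unique h2
  rw [hwŵ, map_smul, hŵeq, map_smul, smul_comm]

/-- **Transversality makes `DΛ_θ̂` injective**: if `⟪V y, y − c⟫ > 0` on `S_μ(c)` (`μ > 0`),
then `DΛ_θ̂` is injective at every unit vector `θ̂` (it maps `θ̂` to `2V` and `θ̂^⊥` isometrically,
up to the factor `μ`, onto the tangent space of `S_μ(c)`). [cite: Geiges2008, Lemma 5.2.4] -/
theorem flowOut_fderiv_injective (hθ : ContDiff ℝ ∞ θ) (hθ0 : ∀ x, θ (0, x) = x)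
    (hflow : ∀ x t, HasDerivAt (fun t => θ (t, x)) (V (θ (t, x))) t) (hμ : 0 < μ)
    (hout : ∀ y : E4, ‖y - c‖ = μ → 0 < inner ℝ (V y) (y - c))
    (hΛ : ∀ z, Λ z = θ (2 * Real.log ‖z‖, c + μ • A (‖z‖⁻¹ • z))) {z : E4} (hz : ‖z‖ = 1) :
    Injective (fderiv ℝ Λ z) := by
  have hz0 : z ≠ 0 := by
    rw [← norm_ne_zero_iff, hz]; exact one_ne_zero
  set L := fderiv ℝ Λ z with hL
  have hLz : L z = (2 : ℝ) • V (c + μ • A z) := by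
    rw [hL, flowOut_fderiv_self hθ hflow hΛ hz0, flowOut_sphere hθ0 hΛ hz]
  have hpos : 0 < inner ℝ (V (c + μ • A z)) (A z) := by
    have h := hout (c + μ • A z) (by
      rw [add_sub_cancel_left, norm_smul, Real.norm_of_nonneg hμ.le, A.norm_map, hz, mul_one])
    rw [add_sub_cancel_left, real_inner_smul_right] at h
    exact pos_of_mul_pos_right h hμ.le
  rw [injective_iff_map_eq_zero]
  intro v hv
  -- decompose `v = a θ̂ + v⊥`
  set a : ℝ := inner ℝ v z with ha
  set vp : E4 := v - a • z with hvp
  have hvpz : inner ℝ vp z = 0 := by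
    rw [hvp, inner_sub_left, real_inner_smul_left, real_inner_self_eq_norm_sq, hz, one_pow, mul_one,
      ← ha, sub_self]
  have hvdec : v = a • z + vp := by rw [hvp, add_sub_cancel]
  have hLvp : L vp = μ • A vp := flowOut_fderiv_tangent hθ hθ0 hΛ hz vp hvpz
  have hsum : a • ((2 : ℝ) • V (c + μ • A z)) + μ • A vp = 0 := by
    rw [← hLz, ← hLvp, ← map_smul, ← map_add, ← hvdec, hv]
  -- pair with `A θ̂`
  have hinner := congrArg (fun x : E4 => inner ℝ x (A z)) hsum
  simp only [inner_add_left, real_inner_smul_left, inner_zero_left, A.inner_map_map, hvpz,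
    mul_zero, add_zero] at hinner
  have ha0 : a = 0 := by
    rcases mul_eq_zero.1 hinner with h | h
    · exact h
    · rcases mul_eq_zero.1 h with h | h
      · norm_num at h
      · exact absurd h hpos.ne'
  rw [ha0, zero_smul, zero_add, smul_eq_zero] at hsum
  rcases hsum with h | h
  · exact absurd h hμ.ne'
  · have hvp0 : vp = 0 := by simpa using h
    rw [hvdec, ha0, zero_smul, zero_add, hvp0]

end FlowOut

/-- **The flow-out map of the Liouville collar, pointwise calculus** (`helper_kjFlowOutCalc`).
For a smooth flow `θ` of a smooth field `V` (`θ(0, x) = x`, `∂ₜθ = V ∘ θ`), `μ > 0`, a linear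
isometry `A` and `Λ z = θ(2 log ‖z‖, c + μ A(z/‖z‖))`: `Λ` is smooth off `0` with
`DΛ_z z = 2 V(Λ z)`; on the unit sphere `Λ θ̂ = c + μ A θ̂`, `DΛ_θ̂ w = μ A w` for `w ⊥ θ̂`, and
`DΛ_θ̂` is injective as soon as `V` is transverse to `S_μ(c)` (`⟪V y, y − c⟫ > 0`).
[cite: Geiges2008, Lemma 5.2.4] -/
theorem helper_kjFlowOutCalc :
    ∀ (θ : ℝ × E4 → E4) (V : E4 → E4) (c : E4) (μ : ℝ) (A : E4 ≃ₗᵢ[ℝ] E4) (Λ : E4 → E4),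
      ContDiff ℝ ∞ θ → (∀ x, θ (0, x) = x) →
      (∀ x t, HasDerivAt (fun t => θ (t, x)) (V (θ (t, x))) t) → 0 < μ →
      (∀ z, Λ z = θ (2 * Real.log ‖z‖, c + μ • A (‖z‖⁻¹ • z))) →
      (∀ z : E4, z ≠ 0 → ContDiffAt ℝ ∞ Λ z ∧ fderiv ℝ Λ z z = (2 : ℝ) • V (Λ z)) ∧
      (∀ z : E4, ‖z‖ = 1 → Λ z = c + μ • A z ∧
        (∀ w : E4, inner ℝ w z = 0 → fderiv ℝ Λ z w = μ • A w) ∧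
        ((∀ y : E4, ‖y - c‖ = μ → 0 < inner ℝ (V y) (y - c)) → Injective (fderiv ℝ Λ z))) := by
  intro θ V c μ A Λ hθ hθ0 hflow hμ hΛ
  refine ⟨fun z hz => ⟨flowOut_contDiffAt hθ hΛ hz, flowOut_fderiv_self hθ hflow hΛ hz⟩,
    fun z hz => ⟨flowOut_sphere hθ0 hΛ hz, fun w hw => flowOut_fderiv_tangent hθ hθ0 hΛ hz w hw,
      fun hout => flowOut_fderiv_injective hθ hθ0 hflow hμ hout hΛ hz⟩⟩

end Summit.SmoothPoincare4.SmoothPoincare4.Theorems.Target.KaehlerJacket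

end
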